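import Summits.ResolutionOfSingularities.ResolutionOfSingularities.Theorems.FrobeniusClosingPatchingRelPerfectDepthSepFormat
import Summits.ResolutionOfSingularities.ResolutionOfSingularities.Theorems.FrobeniusClosingPatchingRelPerfectDepthFlagDetectsOrder
import Summits.ResolutionOfSingularities.ResolutionOfSingularities.Theorems.FrobeniusClosingPatchingRelPerfectDepthSNCExchange
import Summits.ResolutionOfSingularities.ResolutionOfSingularities.Theorems.FrobeniusClosingPatchingRelPerfectDepthGradedFormat
import Literature.AlgebraicGeometry.Resolution.BlowupRestrictOpen
import Literature.AlgebraicGeometry.Resolution.BlowupChartMembership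
import Literature.AlgebraicGeometry.Resolution.SncSaturatedCentre
import Literature.AlgebraicGeometry.Resolution.AlterationsProofs
import Summits.ResolutionOfSingularities.ResolutionOfSingularities.Theorems.FrobeniusClosingPatchingRelPerfectDepthFlagFormat
import Summits.ResolutionOfSingularities.ResolutionOfSingularities.Theorems.FrobeniusClosingPatchingRelPerfectDepthFlagTargets
import HarnessLib

/-!
# Chain W5.2 — F6 JUNCTION (T6-J), X-side bridge: END₁ of the flag ⇒ the host is regular along `E`
# ⇒ the stage-2 format `SepFormat i K ⊤ []`

[OURS · L1 W5.2 · res-D-pv-052 AS res-L1-w52-stub-7 (second hand for res-D-pv-016 AS stub-5, the T6-X2 / T6-J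
owner; offer 2026-08-27T10:29:31Z); crux `PatchingRelPerfect` stmt-ResolutionOfSingularities-16161.]  NOT a
statement of the manuscript under review (Hironaka 2017); AI-written, weaker than expert review; fact-free.

THE BRIDGE in the currency of res-L1-w52-lead-1's retraction PAIR (the data of `FlagFormat`, without naming it):
`i : E ⟶ X` a closed immersion of regular schemes with `𝓘_E` effective Cartier, factoring as `k ≫ V.ι` through an
open `V ⊆ X` which carries a retraction `r : V ⟶ E` (`k ≫ r = 𝟙`); `𝓗` an effective Cartier host with
`K ≤ 𝓗 ⊔ 𝓘_E²` (e.g. `HostMonoFormat 2 i K 𝓗 ⊤`); and END₁ of stage 1, `ord_z (K|_E ⊔ R₁²) ≤ 1` at every `z`, for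
`R₁ = coeffFlag k r 1 (K|_V)` (plan-1's `EndFlag (K|_E) R₁`, TargetsF6 v1.2 §1).  Then at every point `i z` of
`H ∩ i(E)` the host has a generator outside `𝔪²`, i.e. `SNCWithAt [𝓗] ⊤ (i z)`: res-L1-w52-stub-1's KEY OBSERVATION
`DepthFlag.exists_generator_host_not_mem_sq_of_flag` (p518040) read on `V` (where the pair lives) and carried to
`X` along the open immersion `V.ι` (`stalkIdeal_comap_le_maximalIdeal_pow_iff_of_isIso_stalkMap`); and
res-D-pv-016's `SepFormat.initial_of_hostMonoFormat` (p520204) puts the state in the stage-2 format with `N = ⊤`,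
`𝒟 = []`.

* `DepthSNC.sncWithAt_singleton_of_not_le_sq` — an effective Cartier host with `𝓗_x ⊄ 𝔪_x²` is snc at `x`;
* `DepthGraded.SepFormat.hostRegular_of_flagPair` — the bridge proper;
* `DepthGraded.SepFormat.initial_of_flagPair` — `SepFormat i K ⊤ []` from the pair data + END₁ (the content of
  T6-J with `DepthInvariant 2` / `FlagFormat` unpacked);
* **`DepthGraded.initialSep_flagFormat_sepFormat : DepthTargets.InitialSep FlagFormat SepFormat`** — TARGET T6-J BY
  NAME (plan-1's `InitialSep`, module `…DepthFlagTargets` p522533 filed by res-D-pv-059 AS lead-2; lead-1's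
  `DepthGraded.FlagFormat` p523706; res-D-pv-016's `DepthGraded.SepFormat` p520204).

## References
* H. Kawanoue, K. Matsuki, arXiv:1205.4556 (2016), §2. [KawanoueMatsuki2016]
* J. Kollár, *Lectures on Resolution of Singularities* (2007), (3.111) Step 3. [Kollar2007]
* H. Matsumura, *Commutative Ring Theory* (1987), Thm. 14.2. [Matsumura1987]
-/

-- `Summit.<Summit>.<Sub>.Theorems` with `Sub = Summit` (single-conjunct summit, D-0017)
set_option linter.dupNamespace false

noncomputable section

open CategoryTheory CategoryTheory.Limits AlgebraicGeometry TopologicalSpace IsLocalRing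
open Literature.AlgebraicGeometry.Resolution
open Scheme.IdealSheafData

namespace Summit.ResolutionOfSingularities.ResolutionOfSingularities.Theorems

universe u

namespace DepthSNC

/-- **An effective Cartier host of order one is snc at the point**: `𝒪_{X,x}` regular, `𝓗` effective Cartier,
`x ∈ cosupp 𝓗` and `𝓗_x ⊄ 𝔪_x²` ⟹ `SNCWithAt [𝓗] ⊤ x` (the local equation is a regular parameter; res-type-049's
`SNCWithAt.singleton_of_span_singleton`). [cite: Matsumura1987, Thm. 14.2] -/
theorem sncWithAt_singleton_of_not_le_sq {X : Scheme.{u}} (𝓗 : X.IdealSheafData) (x : X)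
    [hreg : IsRegularLocalRing (X.presheaf.stalk x)] (h𝓗 : IsEffectiveCartier 𝓗) (hx : x ∈ 𝓗.support)
    (h2 : ¬ stalkIdeal 𝓗 x ≤ maximalIdeal (X.presheaf.stalk x) ^ 2) :
    SNCWithAt [𝓗] ⊤ x := by
  obtain ⟨F, -, hF⟩ := h𝓗.exists_stalkIdeal_eq_span x
  have hne : stalkIdeal 𝓗 x ≠ ⊤ := (mem_support_iff_stalkIdeal_ne_top 𝓗 x).mp hx
  have hFm : F ∈ maximalIdeal (X.presheaf.stalk x) := by
    by_contra hu
    apply hne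
    rw [hF, Ideal.span_singleton_eq_top]
    exact (IsLocalRing.notMem_maximalIdeal).mp hu
  have hF2 : F ∉ maximalIdeal (X.presheaf.stalk x) ^ 2 := fun h =>
    h2 (by rw [hF, Ideal.span_singleton_le_iff_mem]; exact h)
  exact SNCWithAt.singleton_of_span_singleton hreg hF hFm hF2

end DepthSNC

namespace DepthGraded

namespace SepFormat

variable {E X : Scheme.{u}} {i : E ⟶ X} {K : X.IdealSheafData}

/-- [OURS · L1 W5.2] **THE BRIDGE (KEY OBSERVATION, scheme form): END₁ of the flag makes the host regular along
`E`.**  `X` regular locally Noetherian, `E` regular, `i : E ⟶ X` a closed immersion with `𝓘_E` effective Cartier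
factoring as `k ≫ V.ι` through an open `V` with a retraction `r` (`k ≫ r = 𝟙`); `𝓗` effective Cartier with
`K ≤ 𝓗 ⊔ 𝓘_E²`; if `ord_z (K|_E ⊔ (coeffFlag k r 1 (K|_V))²) ≤ 1` at every `z` (`EndFlag`), then
`SNCWithAt [𝓗] ⊤ (i z)` at every `z` with `i z ∈ cosupp 𝓗`.  (res-L1-w52-stub-1's
`exists_generator_host_not_mem_sq_of_flag` on `V`, where `coeffFlag k r 0 (K|_V) = K|_E` and `ker k = 𝓘_E|_V`;
transported along the open immersion `V.ι`.) [cite: KawanoueMatsuki2016, §2] [cite: Matsumura1987, Thm. 14.2] -/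
theorem hostRegular_of_flagPair [IsLocallyNoetherian X] [IsClosedImmersion i] (hX : Scheme.IsRegular X)
    (hE : Scheme.IsRegular E) (hPi : IsEffectiveCartier i.ker) {𝓗 : X.IdealSheafData}
    (h𝓗 : IsEffectiveCartier 𝓗) (hK : K ≤ 𝓗 ⊔ i.ker ^ 2)
    {V : X.Opens} {k : E ⟶ (V : Scheme.{u})} {r : (V : Scheme.{u}) ⟶ E}
    (hki : k ≫ V.ι = i) (hkr : k ≫ r = 𝟙 E)
    (hEnd : ∀ z : E, idealOrder (K.comap i ⊔ coeffFlag k r 1 (K.comap V.ι) ^ 2) z ≤ 1) :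
    ∀ z : E, i.base z ∈ 𝓗.support → DepthSNC.SNCWithAt [𝓗] ⊤ (i.base z) := by
  intro z hz
  haveI : IsClosedImmersion k := isClosedImmersion_factor hki
  have hPk : IsEffectiveCartier k.ker := by rw [ker_factor hki]; exact hPi.comap_ι V
  have hV : Scheme.IsRegular (V : Scheme.{u}) := Scheme.IsRegular.of_isOpenImmersion V.ι hX
  have h𝓗V : IsEffectiveCartier (𝓗.comap V.ι) := h𝓗.comap_ι V
  have hKV : K.comap V.ι ≤ 𝓗.comap V.ι ⊔ k.ker ^ 2 := by
    rw [ker_factor hki, ← comap_pow, ← Scheme.IdealSheafData.comap_sup]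
    exact Scheme.IdealSheafData.comap_mono V.ι hK
  have hflag : idealOrder (coeffFlag k r 0 (K.comap V.ι) ⊔ coeffFlag k r 1 (K.comap V.ι) ^ 2) z ≤ 1 := by
    rw [coeffFlag_zero, ← Scheme.IdealSheafData.comap_comp, hki]
    exact hEnd z
  obtain ⟨F, -, hF, hF2⟩ :=
    DepthFlag.exists_generator_host_not_mem_sq_of_flag k r hV hE hkr hPk h𝓗V hKV z hflag
  -- the point `i z = V.ι (k z)`; carry `(𝓗|_V)_{kz} ⊄ 𝔪²` to `𝓗_{iz} ⊄ 𝔪²` along the open immersion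
  have hx : i.base z = V.ι.base (k.base z) := by
    rw [← hki, Scheme.Hom.comp_base, TopCat.coe_comp, Function.comp_apply]
  rw [hx] at hz ⊢
  haveI : IsRegularLocalRing (X.presheaf.stalk (V.ι.base (k.base z))) := hX _
  have h2 : ¬ stalkIdeal 𝓗 (V.ι.base (k.base z)) ≤
      maximalIdeal (X.presheaf.stalk (V.ι.base (k.base z))) ^ 2 := by
    rw [← stalkIdeal_comap_le_maximalIdeal_pow_iff_of_isIso_stalkMap V.ι 𝓗 (k.base z) 2, hF,
      Ideal.span_singleton_le_iff_mem]
    exact hF2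
  exact DepthSNC.sncWithAt_singleton_of_not_le_sq 𝓗 _ h𝓗 hz h2

/-- [OURS · L1 W5.2] **T6-J, content: from END₁ to the stage-2 format** — at a host state `K = 𝓗 ⊔ 𝓘_E²`
(`HostMonoFormat 2 i K 𝓗 ⊤`) carried by a retraction pair `(V, k, r)` whose flag has order `≤ 1` everywhere
(`EndFlag (K|_E) (coeffFlag k r 1 (K|_V))`), the stage-2 format holds with `N = ⊤` and the EMPTY boundary:
`SepFormat i K ⊤ []` (res-D-pv-016's `initial_of_hostMonoFormat` fed by `hostRegular_of_flagPair`).  This is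
plan-1's `InitialSep FlagFormat SepFormat` (TargetsF6 v1.2 §3) with `DepthInvariant 2` / `FlagFormat` unpacked.
[cite: KawanoueMatsuki2016, §2] [cite: Kollar2007, (3.111) Step 3] -/
theorem initial_of_flagPair [IsLocallyNoetherian X] [IsClosedImmersion i] (hX : Scheme.IsRegular X)
    (hE : Scheme.IsRegular E) (hPi : IsEffectiveCartier i.ker) {𝓗 : X.IdealSheafData}
    (hfmt : HostMonoFormat 2 i K 𝓗 ⊤)
    {V : X.Opens} {k : E ⟶ (V : Scheme.{u})} {r : (V : Scheme.{u}) ⟶ E}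
    (hki : k ≫ V.ι = i) (hkr : k ≫ r = 𝟙 E)
    (hEnd : ∀ z : E, idealOrder (K.comap i ⊔ coeffFlag k r 1 (K.comap V.ι) ^ 2) z ≤ 1) :
    SepFormat i K ⊤ ([] : List (E.IdealSheafData × ℕ)) := by
  have hK : K ≤ 𝓗 ⊔ i.ker ^ 2 := by
    rw [hfmt.2, Scheme.IdealSheafData.top_mul]
  exact initial_of_hostMonoFormat hX hE hPi hfmt (hostRegular_of_flagPair hX hE hPi hfmt.1 hK hki hkr hEnd)

end SepFormat

end DepthGraded


namespace DepthGraded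

/-- [OURS · L1 W5.2] **TARGET T6-J BY NAME: `InitialSep FlagFormat SepFormat`** (res-L1-w52-plan-1's TargetsF6 v1.2 §3,
module `…DepthFlagTargets` p522533): at a stage-1 state (`DepthInvariant 2`, lead-1's `FlagFormat i K R₁` p523706) with
`EndFlag (K|_E) R₁`, the stage-2 format `SepFormat i K ⊤ []` holds — `SepFormat.initial_of_flagPair` with the
invariant and the flag format unpacked (`R₁ = coeffFlag k r 1 (K|_V)`). [cite: KawanoueMatsuki2016, §2]
[cite: Kollar2007, (3.111) Step 3] -/
theorem initialSep_flagFormat_sepFormat : DepthTargets.InitialSep FlagFormat SepFormat := by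
  intro S _ _ I E X i g K R₁ hinv hQ₁ hEnd
  obtain ⟨⟨𝓗, hfmt⟩, V, k, r, hki, hkr, -, hR₁⟩ := hQ₁
  haveI := hinv.isNoetherian
  haveI := hinv.isClosedImmersion
  refine SepFormat.initial_of_flagPair hinv.isRegular hinv.isRegular_exc hinv.isEffectiveCartier_ker hfmt hki hkr
    fun z => ?_
  rw [hR₁]
  exact hEnd z

end DepthGraded

end Summit.ResolutionOfSingularities.ResolutionOfSingularities.Theorems

end
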